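import Summits.QuantumFields.BalabanUV.T4Continuum.Spine.BackgroundResolventTower
import Summits.QuantumFields.BalabanUV.T4Continuum.Support.OutputRateTowerSocket
import Summits.QuantumFields.BalabanUV.T4Continuum.Support.PlantedPotentialRate

/-!
# OutputRateTowerInstance — row NE5's owner item (h′): the socket's `TowerLaw` (W1's carrier law) INSTANTIATED BY NAME from
# row NE2's perturbed one-step law `BackgroundResolventTower.oneStepAveragedLaw_perturbed` (the U ≠ 1 layer opened by the
# resolvent route), and the row-NE5 END faces restated with it: on the tower-readable operator species NO η-rate LAW binder
# is left — what is displayed instead is row NE2's typed residual `PerturbationLaws` ((H-bd)/(H-cons)) per background index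
# (cell `pub-balaban`, T⁴-continuum fan-out, `HOME/BINDER-OWNERS.md` row NE5, owner lineage t4-ne5-p1, generation 27;
# LEAN PLACEMENT RULE 2026-08-19: the cell's own bookkeeping lives under `Summits/`)

HONEST FRAMING (T4-DAG PAGE 1).  The cell's T⁴ target is rung (B)+1: existence AND uniqueness of the ε → 0 limit of
gauge-invariant observables on a FIXED finite torus T⁴ — NOT infinite volume, NOT a mass gap, NOT the Clay problem.  The
spine estimate NE5 («η-rate of the one-step outputs as functionals of V», shape `T4OutputRate.NE5`) is NOT PRINTED in
[Balaban1987RG1]–[Balaban1989LargeFieldII] (the papers print ε-UNIFORM BOUNDS, never two-spacing RATES; cell GAPS G-t4-U3-1)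
and is NOT PROVED here or anywhere in the tree.  Row NE2's inequalities (H-bd)/(H-cons) for Bałaban's covariant
`P(U) = Δ_a(U) − Δ_a` are NOT PRINTED either ([Balaban1985BackgroundPropagators] prints η-uniform bounds only; cell GAPS
G-t4-U1a-1) and are NOT PROVED here: they are the HYPOTHESIS SHAPE `BackgroundResolventTower.PerturbationLaws` of the imported
row-NE2 module, displayed below as a binder PER BACKGROUND INDEX and asserted by nobody.  Every `StepModel`, every free tower
datum `D, A, Jinj, F`, every perturbation family `P j` and every reading map is ABSTRACT DATA; nothing of Bałaban's text is
asserted; no «…» print quotation is introduced (0 cite tags; the located print of every wall is in the imported leaves'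
docstrings and in the lineage record `t4/T4-EST-NE5-P1.md`).  `FlowStep.BetaPertH`, (B), (B^μ) do not occur and are NOT hidden:
they would enter only through the window `W` and the constants of whoever instantiates the step model.  Spine estimates PROVED:
0/9, unchanged.  HONEST DEPENDENCY (cell, verbatim): continuum YM on T⁴ ⇐ BetaPertH ∧ nine spine estimates (0/9 proved);
BetaPertH ⇐ (D1) ∧ (D4) ∧ CAP+tail; G-an2-4 gates asym, D1 and NE2/3/4.  (Row NE2, generation 9, records the correction that
its U ≠ 1 layer is NOT gated by G-an2-4 — a U = 1 row —; on the resolvent route its residual is `PerturbationLaws`.)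

WHAT THIS MODULE IS.  Generation 26 wrote the JUNCTION `Support/OutputRateTowerSocket` ahead of time: row NE5's wall W1
(`StepModel.OperatorRate`) fed from a FAMILY of averaging towers obeying row NE2's typed wall
`CovariantAveragingTower.OneStepAveragedLaw` with ONE constant and ONE rate (`TowerLaw A X r Cop θ`) through the READING binder
`ReadsTower` (MI-R-op), and the END faces `ne5_at_of_towerLaw_lip{,_readsIns}_nat` / `ne5_at_of_towerLaw_split{,_readsIns}_nat`;
`HOME/BINDER-OWNERS.md` row NE5 dated item (h′) as «≤ 1 generation after row NE2 lands an INSTANCE of `OneStepAveragedLaw` at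
U ≠ 1: instantiate `TowerLaw` BY NAME».  Row NE2's generation 9 has now landed that instance on the RESOLVENT ROUTE
(`Spine/BackgroundResolventLaw` + `Spine/BackgroundResolventTower`): for free operators `D_k` (invertible), one-step averagings
`A_k` (`‖A_k‖² ≤ r⁻¹`), injections `J_k`, pairing defects `F_k` obeying the U = 1 bundle `FreeTowerLaws D A J F r e₀ e₁ f`, and a
perturbation family `P_k` obeying the typed U ≠ 1 bundle `PerturbationLaws D P J κ e₂`, every coupling `‖t‖κ < 1` gives
`OneStepAveragedLaw A r (k ↦ (D_k + tP_k)⁻¹) (Epert κ e₀ e₁ e₂ f t)`, and geometric defects give `Epert ≤ Cpert(t)·ρ^k`.  This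
leaf is item (h′) executed — instantiation and nothing else:

* §1 GLUE: `oneStepAveragedLaw_mono` (the law is monotone in its error sequence), `towerLaw_of_dominated` (per-index laws
  with errors dominated UNIFORMLY by `Cop·θ^k` ⇒ `TowerLaw`: where an instantiation's uniformity lives), `towerContracting_const`.
* §2 THE INSTANCE: `pertTower D P t j k = (D_k + t·P_j,k)⁻¹` — one perturbation family `P j` per BACKGROUND INDEX `j : Jx` over
  ONE free carrier; `towerContracting_perturbed`; **`towerLaw_perturbed`**: `FreeTowerLaws` (geometric `e₀, e₁, f ≤ C·ρ^k`) ∧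
  (∀ j, `PerturbationLaws D (P j) J κ (e₂ j)`, `e₂ j ≤ C₂ρ^k` UNIFORMLY in `j`) ∧ `‖t‖κ < 1` ⟹
  `TowerLaw (fun _ => A) (pertTower D P t) r (Cpert κ C₀ C₁ C₂ C_f t) ρ` — ONE constant, ONE rate for the whole family
  (`oneStepAveragedLaw_perturbed` + `Epert_le_Cpert` BY NAME); `Cpert_nonneg`; **`operatorRate_of_perturbed_floor`**: + the
  reading `ReadsTower M (fun _ => A) (pertTower D P t) r W cR tow` + an [I]-type margin floor ⟹ W1
  `StepModel.OperatorRate W (cR·Cpert(t)/r₀) ρ`.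
* §3 THE ROW-NE5 END FACES WITH THIS W1 (the socket's faces BY NAME): **`ne5_at_of_perturbed_lip_readsIns_nat`** (W4 PRODUCED
  by `OutputRateInsertion.insertionRate_of_operatorRate`; binders of η-rate LAW type: NONE; displayed instead: `hfree`, `hpert`
  (per index), the defect constants, `‖t‖κ < 1`, the reading `hread`, the floor, MI-R, W2, W2-ins, W3, `ReadsIns`, R, S) and
  **`ne5_at_of_perturbed_split_readsIns_nat`** (the minimiser split of the socket's §3b: towers at rate `θ₂ ≤ θ` on the pair
  (run A, `opMid`) + background-Lipschitz × row NE3's `T4EtaRateMin.LocalRate R Cm θ` — the one rate-type binder left, `hR`).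
* §4 (v1.1) ON BAŁABAN's `Δ_a` WITH KING's AVERAGING AND PAIRING (row NE2's `NE2PerturbedLayer.freeTowerLaws_king` — the U = 1 bundle is a
  THEOREM): **`towerLaw_perturbed_king`** (the only binder of NE2 type is the per-background `PerturbationLaws`), and the FIRST MODEL CLASS WITH NO
  BINDER OF NE2 TYPE AT ALL — unit-lattice operators `‖B j‖ ≤ b` planted along King's pairings (row NE2's
  `PlantedPotentialRate.perturbationLaws_plantTow`, King's `(Δ^{(k)} + B)⁻¹` structure on Bałaban's vector layer):
  **`towerLaw_plantedPotential`** (`Cpert (b·Cst) (2dCst) CJ 0 0 t`, rate `L^{−1}`,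
  UNCONDITIONAL for `‖t‖·b·Cst < 1`) and the END face **`ne5_at_of_plantedPotential_lip_readsIns_nat`**: for operator species read from these towers NE5
  follows from the reading, the floor, MI-R, W2, W2-ins, W3, `ReadsIns`, R, S — no binder of NE2 type, no η-rate law binder.

WHAT THIS BUYS FOR ROW NE5's CENSUS (numbers, not adjectives).  Route P1's wall list was W1 (= NE2-law (+ NE3 `LocalRate` in
the split)) ∕ W2-op ∕ W2-hist ∕ W2-ins ∕ W3 ∕ MI-R (+ ReadsIns + ReadsTower) ∕ S ∕ R.  After this leaf, for the operator species
an instantiation reads from perturbed free towers, W1 carries NO law hypothesis: its η-rate is row NE2's kernel theorem, and its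
U ≠ 1 INPUT is the per-background membership `PerturbationLaws D (P j) J κ (e₂ j)` — two inequalities of U = 1 flavour ((H-bd):
relative boundedness of the background perturbation, the TYPE of the printed uniform bounds (1.89)/(3.42); (H-cons): two-spacing
consistency read through one free propagator on each side), which row NE2 generation 9 discharges from smoothness alone for a
first-order (minimal-coupling) model in its own files.  K-uniformity ledger (record §50.8/§52.4 (d)): W1's constant is
`cR·Cpert(κ, C₀, C₁, C₂, C_f, t)/r₀` — K-uniform iff the defect constants and `κ` are, at fixed coupling.  NOTHING ELSE MOVES:
W2-op ∕ W2-hist ∕ W2-ins ∕ W3 ∕ MI-R (+ the readings) ∕ S ∕ R are as before; NE5 is NOT PRINTED and NOT PROVED.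

SCOPE OF THE INSTANCE (said once, honestly).  (i) ONE free carrier: every tower of the family shares the free data `D, A, J, F`
(one torus, one free operator, King's — or any law-abiding — averaging OUTSIDE the background); the background enters ONLY as
the perturbation `P j` of the free operator (row NE2's resolvent representation; no covariant carrier `Δ_U`, `Q(U)` is
constructed — none exists in the tree at two spacings; covariant outer averagings are row NE2's residual (R9.xiii)).  Several
tori or free operators = a disjoint union of such families, each with its own `FreeTowerLaws` (§1's `towerLaw_of_dominated`
covers any index set).  (ii) The smallness `‖t‖κ < 1` is GLOBAL (background small in one gauge on the whole torus — row NE2's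
stated scope; Bałaban's local small-field regime with large fields elsewhere is NOT reached).  (iii) Which operator species of
[Balaban1988RG2Cluster]'s step are tower-readable, and from which background index, is the READING `tow`/`hread` of an instantiation
(liaison (L2)), not a theorem — unchanged from the socket.

VERSION.  v1.1 = v1 (p205877) + §4 (APPEND-ONLY: `towerLaw_perturbed_king`, `towerLaw_plantedPotential`, `ne5_at_of_plantedPotential_lip_readsIns_nat`;
one added import `Support/PlantedPotentialRate` (row NE2, which imports `Spine/NE2PerturbedLayer`); every v1 declaration byte-identical; header: this
paragraph, the §4 bullet, one bib-key typo corrected in «SCOPE OF THE INSTANCE» (iii)).  A first-order face on row NE2's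
`FirstOrderBackgroundModel.perturbationLaws_firstOrder` (family of `LipschitzBackground (V j) α β`) follows the same way once that module is in the tree.

WHAT IS PROVED: real bookkeeping only (monotonicity of the law in its error, one non-negativity, compositions of the imported
theorems BY NAME).  0 sorry; axioms ⊆ {propext, Classical.choice, Quot.sound}; imports the LANDED modules
`Spine/BackgroundResolventTower` (row NE2), `Support/OutputRateTowerSocket` (row NE5, v1.1 p203797) and — from v1.1 — `Support/PlantedPotentialRate`
(row NE2; it imports `Spine/NE2PerturbedLayer`), and modifies nothing of them.  NOT COVERED: `PerturbationLaws` for Bałaban's covariant `Δ_a(U) − Δ_a`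
(row NE2's residual (R9.iv′)); the first-order Lipschitz-background instance (row NE2's `Support/FirstOrderBackgroundModel`, consumed the same way once in
the tree); `LocalRate` for minimisers (row NE3); any W2/W3/MI-R binder for Bałaban's objects; NE2, NE3, NE5, BetaPertH, (B), (B^μ).  Rung (B)+1
finite T⁴; NOT summit progress.
-/

noncomputable section

open Set Metric
open scoped Matrix Matrix.Norms.L2Operator

namespace Summit.QuantumFields.BalabanUV.T4Continuum.OutputRateTowerInstance

open Literature.MathematicalPhysics.QuantumFieldTheory.Balaban1983to89
open Literature.MathematicalPhysics.QuantumFieldTheory.Balaban1983to89.T4OutputRate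
open Literature.MathematicalPhysics.QuantumFieldTheory.Balaban1983to89.T4InputCauchyRateData
open Literature.MathematicalPhysics.QuantumFieldTheory.Balaban1983to89.T4OperatorRateLiaison
open Literature.MathematicalPhysics.QuantumFieldTheory.Balaban1983to89.T4EtaRateMin
open Summit.QuantumFields.BalabanUV.T4Continuum.CovariantAveragingTower
open Summit.QuantumFields.BalabanUV.T4Continuum.BackgroundResolventTower
open Summit.QuantumFields.BalabanUV.T4Continuum.OutputRateInsertion
open Summit.QuantumFields.BalabanUV.T4Continuum.OutputRateTowerSocket

/-! ## §1 Generic glue: dominated error sequences, one constant for a family -/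

section Glue

variable {ι : ℕ → Type*} [∀ k, Fintype (ι k)] [∀ k, DecidableEq (ι k)]

/-- Row NE2's one-step averaged law is MONOTONE in its error sequence (for `r ≥ 0`). [folklore] -/
theorem oneStepAveragedLaw_mono {A : (k : ℕ) → Matrix (ι k) (ι (k + 1)) ℂ} {r : ℝ} {X : (k : ℕ) → Matrix (ι k) (ι k) ℂ}
    {e e' : ℕ → ℝ} (hr : 0 ≤ r) (h : OneStepAveragedLaw A r X e) (hle : ∀ k, e k ≤ e' k) :
    OneStepAveragedLaw A r X e' :=
  fun k => (h k).trans (mul_le_mul_of_nonneg_left (hle k) (inv_nonneg.mpr hr))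

variable {J : Type*} {κ : J → ℕ → Type*} [∀ j k, Fintype (κ j k)] [∀ j k, DecidableEq (κ j k)]

/-- **ONE CONSTANT FOR A FAMILY**: per-index laws with error sequences `e j` dominated UNIFORMLY by `Cop·θ^k` give the
socket's `TowerLaw A X r Cop θ` (where an instantiation's uniformity lives: in the domination, not in the law). [folklore] -/
theorem towerLaw_of_dominated {A : (j : J) → (k : ℕ) → Matrix (κ j k) (κ j (k + 1)) ℂ}
    {X : (j : J) → (k : ℕ) → Matrix (κ j k) (κ j k) ℂ} {r : ℝ} {e : J → ℕ → ℝ} {Cop θ : ℝ} (hr : 0 ≤ r)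
    (hlaw : ∀ j, OneStepAveragedLaw (A j) r (X j) (e j)) (hdom : ∀ j k, e j k ≤ Cop * θ ^ k) :
    TowerLaw A X r Cop θ :=
  fun j => oneStepAveragedLaw_mono hr (hlaw j) (hdom j)

/-- A family whose every tower uses the SAME one-step averagings `A₀ k` (one carrier, many level objects) is contracting as
soon as `‖A₀ k‖² ≤ r⁻¹`. [folklore] -/
theorem towerContracting_const {ι₀ : ℕ → Type*} [∀ k, Fintype (ι₀ k)] [∀ k, DecidableEq (ι₀ k)]
    {A₀ : (k : ℕ) → Matrix (ι₀ k) (ι₀ (k + 1)) ℂ} {r : ℝ} (hA : ∀ k, ‖A₀ k‖ ^ 2 ≤ r⁻¹) :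
    TowerContracting (J := J) (fun _ => A₀) r :=
  fun _ k => hA k

end Glue

/-! ## §2 THE INSTANCE: `TowerLaw` for the family of perturbed free towers `(D_k + t·P_j,k)⁻¹`, BY NAME from row NE2's
`BackgroundResolventTower.oneStepAveragedLaw_perturbed` — one constant `Cpert κ C₀ C₁ C₂ C_f t`, one rate `ρ` for the whole
family; the U ≠ 1 content is the per-index binder `PerturbationLaws` (row NE2's typed (H-bd)/(H-cons)), displayed -/

section Perturbed

variable {ι : ℕ → Type*} [∀ k, Fintype (ι k)] [∀ k, DecidableEq (ι k)]

/-- the PERTURBED LEVEL OBJECTS of background index `j` at coupling `t`: `X_j(t) k = (D_k + t·P_j,k)⁻¹` (row NE2's resolvent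
representation `G(U) = (Δ_a + P(U))⁻¹`, one perturbation family `P j` per background datum `j`). [folklore] -/
def pertTower {Jx : Type*} (D : (k : ℕ) → Matrix (ι k) (ι k) ℂ) (P : Jx → (k : ℕ) → Matrix (ι k) (ι k) ℂ) (t : ℂ)
    (j : Jx) (k : ℕ) : Matrix (ι k) (ι k) ℂ :=
  (D k + t • P j k)⁻¹

/-- `pertTower` unfolds (definitional). [folklore] -/
@[simp] theorem pertTower_apply {Jx : Type*} (D : (k : ℕ) → Matrix (ι k) (ι k) ℂ)
    (P : Jx → (k : ℕ) → Matrix (ι k) (ι k) ℂ) (t : ℂ) (j : Jx) (k : ℕ) :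
    pertTower D P t j k = (D k + t • P j k)⁻¹ := rfl

variable {Jx : Type*} {D : (k : ℕ) → Matrix (ι k) (ι k) ℂ} {A : (k : ℕ) → Matrix (ι k) (ι (k + 1)) ℂ}
  {Jinj : (k : ℕ) → Matrix (ι (k + 1)) (ι k) ℂ} {F : (k : ℕ) → Matrix (ι k) (ι k) ℂ} {r κ : ℝ} {e₀ e₁ f : ℕ → ℝ}
  {e₂ : Jx → ℕ → ℝ} {P : Jx → (k : ℕ) → Matrix (ι k) (ι k) ℂ}

/-- `Cpert` is non-negative for non-negative constants inside the Neumann disc. [folklore] -/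
theorem Cpert_nonneg {κ C₀ C₁ C₂ Cf : ℝ} {t : ℂ} (ht : ‖t‖ * κ < 1) (hC₀ : 0 ≤ C₀) (hC₁ : 0 ≤ C₁) (hC₂ : 0 ≤ C₂)
    (hCf : 0 ≤ Cf) : 0 ≤ Cpert κ C₀ C₁ C₂ Cf t := by
  have hν : 0 ≤ (1 - ‖t‖ * κ)⁻¹ := inv_nonneg.mpr (sub_nonneg.mpr ht.le)
  unfold Cpert
  have h1 : 0 ≤ C₁ + ‖t‖ * C₂ := add_nonneg hC₁ (mul_nonneg (norm_nonneg t) hC₂)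
  have h2 : 0 ≤ C₀ + 2 * Cf := by linarith
  positivity

/-- Row NE2's `PerturbationLaws` is MONOTONE in the relative bound `κ` and in the consistency defect `e₂` — so a family of
backgrounds with index-dependent bounds `κ_j ≤ κ`, `e₂,j ≤ e₂` obeys ONE bundle (used by §2's uniform instance). [folklore] -/
theorem perturbationLaws_mono {P₀ : (k : ℕ) → Matrix (ι k) (ι k) ℂ} {κ₀ κ' : ℝ} {e e' : ℕ → ℝ}
    (h : PerturbationLaws D P₀ Jinj κ₀ e) (hκ : κ₀ ≤ κ') (he : ∀ k, e k ≤ e' k) : PerturbationLaws D P₀ Jinj κ' e' where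
  opNorm_P_mul_inv_le := fun k => (h.opNorm_P_mul_inv_le k).trans hκ
  opNorm_inv_mul_P_le := fun k => (h.opNorm_inv_mul_P_le k).trans hκ
  consistent_le := fun k => (h.consistent_le k).trans (he k)

/-- The family sharing ONE carrier of one-step averagings is contracting (`FreeTowerLaws.opNorm_A_sq_le`). [folklore] -/
theorem towerContracting_perturbed (hfree : FreeTowerLaws D A Jinj F r e₀ e₁ f) :
    TowerContracting (J := Jx) (fun _ => A) r :=
  towerContracting_const hfree.opNorm_A_sq_le

/-- **ROW NE5's W1 CARRIER LAW, INSTANTIATED**: under row NE2's `FreeTowerLaws` (U = 1 inputs; a theorem for Bałaban's `Δ_a`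
and King's pairing in row NE2's assembly file) with geometric defects `e₀, e₁, f ≤ C·ρ^k`, and — PER BACKGROUND INDEX `j` — row
NE2's typed U ≠ 1 inequalities `PerturbationLaws D (P j) Jinj κ (e₂ j)` with a UNIFORM geometric consistency defect
`e₂ j k ≤ C₂ρ^k`, every coupling in the Neumann disc `‖t‖κ < 1` gives the socket's
`TowerLaw (fun _ => A) (pertTower D P t) r (Cpert κ C₀ C₁ C₂ C_f t) ρ`: ONE constant and ONE rate for the whole family
(`oneStepAveragedLaw_perturbed` + `Epert_le_Cpert` BY NAME, then §1's domination). [folklore] -/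
theorem towerLaw_perturbed (hr : 0 < r) (hfree : FreeTowerLaws D A Jinj F r e₀ e₁ f)
    (hpert : ∀ j, PerturbationLaws D (P j) Jinj κ (e₂ j)) {ρ C₀ C₁ C₂ Cf : ℝ} (h₀ : ∀ k, e₀ k ≤ C₀ * ρ ^ k)
    (h₁ : ∀ k, e₁ k ≤ C₁ * ρ ^ k) (h₂ : ∀ j k, e₂ j k ≤ C₂ * ρ ^ k) (hf : ∀ k, f k ≤ Cf * ρ ^ k) {t : ℂ}
    (ht : ‖t‖ * κ < 1) : TowerLaw (fun _ : Jx => A) (pertTower D P t) r (Cpert κ C₀ C₁ C₂ Cf t) ρ :=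
  towerLaw_of_dominated (e := fun j => Epert κ e₀ e₁ (e₂ j) f t) hr.le
    (fun j => oneStepAveragedLaw_perturbed hr hfree (hpert j) ht) (fun j k => Epert_le_Cpert ht h₀ h₁ (h₂ j) hf k)

variable {C : Carriers} {Op Hist : Type*} [NormedAddCommGroup Op] [NormedSpace ℂ Op] [NormedAddCommGroup Hist]
  [NormedSpace ℂ Hist] (M : StepModel C Op Hist)

/-- **W1 IN MARGIN UNITS FROM THE PERTURBED TOWERS**: reading `ReadsTower M (fun _ => A) (pertTower D P t) r W cR tow` (which
law-abiding background the step's operator species is read from, at which step) + an [I]-type margin floor `r₀ ≤ rOp k` ⇒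
`StepModel.OperatorRate W (cR·Cpert(t)/r₀) ρ`.  NO η-rate LAW binder: the rate is row NE2's theorem; what is assumed is
`FreeTowerLaws` (U = 1) and `PerturbationLaws` (per index). [folklore] -/
theorem operatorRate_of_perturbed_floor {W : Set (ℕ → ℝ)} {cR r₀ : ℝ} {tow : ℕ → (ℕ → ℝ) → C.BgB → Jx} (hr : 0 < r)
    (hfree : FreeTowerLaws D A Jinj F r e₀ e₁ f) (hpert : ∀ j, PerturbationLaws D (P j) Jinj κ (e₂ j))
    {ρ C₀ C₁ C₂ Cf : ℝ} (h₀ : ∀ k, e₀ k ≤ C₀ * ρ ^ k) (h₁ : ∀ k, e₁ k ≤ C₁ * ρ ^ k) (h₂ : ∀ j k, e₂ j k ≤ C₂ * ρ ^ k)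
    (hf : ∀ k, f k ≤ Cf * ρ ^ k) (hC₀ : 0 ≤ C₀) (hC₁ : 0 ≤ C₁) (hC₂ : 0 ≤ C₂) (hCf : 0 ≤ Cf) (hρ : 0 ≤ ρ) {t : ℂ}
    (ht : ‖t‖ * κ < 1) (hread : ReadsTower M (fun _ : Jx => A) (pertTower D P t) r W cR tow) (hcR : 0 ≤ cR)
    (hfl : ∀ k, r₀ ≤ M.rOp k) (hr₀ : 0 < r₀) : M.OperatorRate W (cR * Cpert κ C₀ C₁ C₂ Cf t / r₀) ρ :=
  operatorRate_of_towerLaw_floor M hr (towerContracting_perturbed hfree)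
    (towerLaw_perturbed hr hfree hpert h₀ h₁ h₂ hf ht) hread hcR (Cpert_nonneg ht hC₀ hC₁ hC₂ hCf) hρ hfl hr₀

end Perturbed

/-! ## §3 Row NE5's END faces with W1 := the perturbed-tower instance (W4 produced; and the minimiser split) -/

section EndFaces

variable {ι : ℕ → Type*} [∀ k, Fintype (ι k)] [∀ k, DecidableEq (ι k)]
variable {Jx : Type*} {D : (k : ℕ) → Matrix (ι k) (ι k) ℂ} {A : (k : ℕ) → Matrix (ι k) (ι (k + 1)) ℂ}
  {Jinj : (k : ℕ) → Matrix (ι (k + 1)) (ι k) ℂ} {F : (k : ℕ) → Matrix (ι k) (ι k) ℂ} {r κP : ℝ} {e₀ e₁ f : ℕ → ℝ}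
  {e₂ : Jx → ℕ → ℝ} {P : Jx → (k : ℕ) → Matrix (ι k) (ι k) ℂ} {C₀ C₁ C₂ Cf : ℝ} {t : ℂ}
variable {C : Carriers} {Op Hist : Type*} [NormedAddCommGroup Op] [NormedSpace ℂ Op] [NormedAddCommGroup Hist]
  [NormedSpace ℂ Hist] [CompleteSpace Hist] (M : StepModel C Op Hist)

/-- **ROW NE5's END WITH NO η-RATE LAW BINDER AT ALL ON THE TOWER-READABLE OPERATOR SPECIES** (W1 := §2's instance, W4
PRODUCED by `OutputRateInsertion.insertionRate_of_operatorRate`).  What is ASSUMED of rate type: NOTHING — row NE2's perturbed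
law is a theorem; its inputs are displayed: `hfree` (U = 1 tower inputs `FreeTowerLaws`, a theorem for Bałaban's `Δ_a` and
King's pairing in row NE2's assembly), `hpert` (PER BACKGROUND INDEX: row NE2's typed U ≠ 1 inequalities (H-bd)/(H-cons) =
`PerturbationLaws`, NOT IN PRINT for Bałaban's `Δ_a(U) − Δ_a`), the geometric defect constants, the coupling `‖t‖κP < 1`;
then the READING `hread` (which law-abiding background the step model's operator data are read from — MI-R-op), the floor,
MI-R, W2, W2-ins (+ `InsBoundA`), W3 (consumed as `InsertionDampedNat`), `ReadsIns`, R, S.  `hδ : cR·Cpert(t)/r₀ = δ`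
abbreviates W1's constant; `δ′ = Gi·δ/(1 − ρ₁) + 2Gi/θ^{k₁}`.  The socket's `ne5_at_of_towerLaw_lip_readsIns_nat` BY NAME.
[folklore] -/
theorem ne5_at_of_perturbed_lip_readsIns_nat (Ins : ℕ → Op → (C.Dom → ℝ) → Hist) {W : Set (ℕ → ℝ)} {cR r₀ δ : ℝ}
    {tow : ℕ → (ℕ → ℝ) → C.BgB → Jx} {EA : Functional C C.BgA} {EB : Functional C C.BgB}
    {κ Λ EA₀ E₀ Gi θ θ' c ω ρ₀ ρ₁ B : ℝ} {k₀ k₁ : ℕ} (hr : 0 < r) (hfree : FreeTowerLaws D A Jinj F r e₀ e₁ f)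
    (hpert : ∀ j, PerturbationLaws D (P j) Jinj κP (e₂ j)) (h₀ : ∀ k, e₀ k ≤ C₀ * θ ^ k) (h₁ : ∀ k, e₁ k ≤ C₁ * θ ^ k)
    (h₂ : ∀ j k, e₂ j k ≤ C₂ * θ ^ k) (hf : ∀ k, f k ≤ Cf * θ ^ k) (hC₀ : 0 ≤ C₀) (hC₁ : 0 ≤ C₁) (hC₂ : 0 ≤ C₂)
    (hCf : 0 ≤ Cf) (ht : ‖t‖ * κP < 1) (hread : ReadsTower M (fun _ : Jx => A) (pertTower D P t) r W cR tow)
    (hcR : 0 ≤ cR) (hfl : ∀ k, r₀ ≤ M.rOp k) (hr₀ : 0 < r₀) (hδ : cR * Cpert κP C₀ C₁ C₂ Cf t / r₀ = δ)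
    (hrA : M.RepresentsA EA W) (hrB : M.RepresentsB EB W) (hbase : M.InBase EB W) (hlip : M.DataLipschitz W κ Λ ρ₀)
    (hdA : DecayBound EA W EA₀ κ) (hdB : DecayBound EB W E₀ κ) (hreadI : (InsOpModel.ofStep M Ins).ReadsIns W)
    (hienv : (InsOpModel.ofStep M Ins).InsOpEnvelope W κ E₀ Gi) (hbdA : (InsOpModel.ofStep M Ins).InsBoundA W κ E₀ Gi)
    (hGi : 0 ≤ Gi) (hρ₁ : ρ₁ < 1) (hreach : δ * θ ^ k₁ ≤ ρ₁) (hdamp : M.InsertionDampedNat W κ c ω) (hΛ : 0 ≤ Λ)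
    (hθ0 : 0 < θ) (hθθ' : θ ≤ θ') (hθ'1 : θ' ≤ 1) (hc : 0 ≤ c) (hω : 0 < ω)
    (hnear : (δ + (Gi * δ / (1 - ρ₁) + 2 * Gi / θ ^ k₁)) * θ ^ k₀ + c * (EA₀ + E₀) / (1 - ω) ≤ ρ₀) (hB : 0 ≤ B)
    (hfirst : ∀ k < k₀, EA₀ + E₀ ≤ B * θ ^ k) (hsmall : ω + Λ * c < θ') :
    NE5 EA EB W κ θ' ((Λ * (δ + (Gi * δ / (1 - ρ₁) + 2 * Gi / θ ^ k₁)) + B) * (θ' - ω) / (θ' - (ω + Λ * c))) := by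
  subst hδ
  exact ne5_at_of_towerLaw_lip_readsIns_nat M Ins hr (towerContracting_perturbed hfree)
    (towerLaw_perturbed hr hfree hpert h₀ h₁ h₂ hf ht) hread hcR (Cpert_nonneg ht hC₀ hC₁ hC₂ hCf) hfl hr₀ hrA hrB hbase
    hlip hdA hdB hreadI hienv hbdA hGi hρ₁ hreach hdamp hΛ hθ0 hθθ' hθ'1 hc hω hnear hB hfirst hsmall

/-- **ROW NE5's END, MINIMISER SPLIT, WITH THE PERTURBED-TOWER INSTANCE** (the socket's §3b BY NAME): W1's first leg = §2's
instance at the towers' rate `θ₂ ≤ θ` read on the pair (run A, `opMid`) (`ReadsTowerMid`), second leg = background-Lipschitz ×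
row NE3's `LocalRate R Cm θ` (the one binder of rate type left, displayed as `hR`); W4 PRODUCED from the same W1;
`hδ : cR·Cpert(t)/r₀ + Λb·Cm = δ`. [folklore] -/
theorem ne5_at_of_perturbed_split_readsIns_nat (Ins : ℕ → Op → (C.Dom → ℝ) → Hist) {W : Set (ℕ → ℝ)}
    {cR r₀ Λb Cm δ θ₂ : ℝ} {tow : ℕ → (ℕ → ℝ) → C.BgB → Jx} (opMid : (ℕ → ℝ) → C.BgB → ℕ → Op)
    (dist : ℕ → (ℕ → ℝ) → C.BgB → ℝ) {ιR XR : Type*} (R : Readings ιR XR) {EA : Functional C C.BgA}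
    {EB : Functional C C.BgB} {κ Λ EA₀ E₀ Gi θ θ' c ω ρ₀ ρ₁ B : ℝ} {k₀ k₁ : ℕ} (hr : 0 < r)
    (hfree : FreeTowerLaws D A Jinj F r e₀ e₁ f) (hpert : ∀ j, PerturbationLaws D (P j) Jinj κP (e₂ j))
    (h₀ : ∀ k, e₀ k ≤ C₀ * θ₂ ^ k) (h₁ : ∀ k, e₁ k ≤ C₁ * θ₂ ^ k) (h₂ : ∀ j k, e₂ j k ≤ C₂ * θ₂ ^ k)
    (hf : ∀ k, f k ≤ Cf * θ₂ ^ k) (hC₀ : 0 ≤ C₀) (hC₁ : 0 ≤ C₁) (hC₂ : 0 ≤ C₂) (hCf : 0 ≤ Cf) (ht : ‖t‖ * κP < 1)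
    (hread : ReadsTowerMid M (fun _ : Jx => A) (pertTower D P t) r W cR tow opMid) (hcR : 0 ≤ cR) (hθ₂ : 0 ≤ θ₂)
    (hθ₂θ : θ₂ ≤ θ) (hfl : ∀ k, r₀ ≤ M.rOp k) (hr₀ : 0 < r₀)
    (hLip : ∀ k, ∀ g ∈ W, ∀ (U : C.BgB), ‖opMid g U k - M.opB g U k‖ ≤ Λb * dist k g U * M.rOp k) (hΛb : 0 ≤ Λb)
    (hR : LocalRate R Cm θ) (hCm : 0 ≤ Cm)
    (hdom : ∀ k, ∀ g ∈ W, ∀ (U : C.BgB), ∃ V ∈ R.dom, ∃ x : XR, dist k g U ≤ |R.loc (k + 1) V x - R.loc k V x|)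
    (hδ : cR * Cpert κP C₀ C₁ C₂ Cf t / r₀ + Λb * Cm = δ) (hrA : M.RepresentsA EA W) (hrB : M.RepresentsB EB W)
    (hbase : M.InBase EB W) (hlip : M.DataLipschitz W κ Λ ρ₀) (hdA : DecayBound EA W EA₀ κ) (hdB : DecayBound EB W E₀ κ)
    (hreadI : (InsOpModel.ofStep M Ins).ReadsIns W) (hienv : (InsOpModel.ofStep M Ins).InsOpEnvelope W κ E₀ Gi)
    (hbdA : (InsOpModel.ofStep M Ins).InsBoundA W κ E₀ Gi) (hGi : 0 ≤ Gi) (hρ₁ : ρ₁ < 1) (hreach : δ * θ ^ k₁ ≤ ρ₁)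
    (hdamp : M.InsertionDampedNat W κ c ω) (hΛ : 0 ≤ Λ) (hθ0 : 0 < θ) (hθθ' : θ ≤ θ') (hθ'1 : θ' ≤ 1) (hc : 0 ≤ c)
    (hω : 0 < ω)
    (hnear : (δ + (Gi * δ / (1 - ρ₁) + 2 * Gi / θ ^ k₁)) * θ ^ k₀ + c * (EA₀ + E₀) / (1 - ω) ≤ ρ₀) (hB : 0 ≤ B)
    (hfirst : ∀ k < k₀, EA₀ + E₀ ≤ B * θ ^ k) (hsmall : ω + Λ * c < θ') :
    NE5 EA EB W κ θ'
      ((Λ * (δ + (Gi * δ / (1 - ρ₁) + 2 * Gi / θ ^ k₁)) + B) * (θ' - ω) / (θ' - (ω + Λ * c))) :=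
  ne5_at_of_towerLaw_split_readsIns_nat M Ins opMid dist R hr (towerContracting_perturbed hfree)
    (towerLaw_perturbed hr hfree hpert h₀ h₁ h₂ hf ht) hread hcR (Cpert_nonneg ht hC₀ hC₁ hC₂ hCf) hθ₂ hθ₂θ hfl hr₀ hLip
    hΛb hR hCm hdom hδ hrA hrB hbase hlip hdA hdB hreadI hienv hbdA hGi hρ₁ hreach hdamp hΛ hθ0 hθθ' hθ'1 hc hω hnear hB
    hfirst hsmall

end EndFaces

/-! ## §4 THE INSTANCE ON BAŁABAN's `Δ_a` WITH KING's AVERAGING AND PAIRING (row NE2's `freeTowerLaws_king`): `FreeTowerLaws`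
is a THEOREM, so the only binder of NE2 type is the per-background `PerturbationLaws`; and the FIRST MODEL CLASS with NO binder
of NE2 type at all — King's planted unit-lattice potentials (row NE2's `perturbationLaws_plantTow`) -/

section KingCarrier

open Literature.MathematicalPhysics.QuantumFieldTheory.Balaban1983to89.B5Prop11Plancherel (Cst Cst_nonneg)
open Summit.QuantumFields.BalabanUV.T4Continuum.BalabanAveragedTowerUnit (idx Qlev)
open Summit.QuantumFields.BalabanUV.T4Continuum.KingPairingPlantedLaw (calDalev JpcT CJ CJ_nonneg)
open Summit.QuantumFields.BalabanUV.T4Continuum.NE2PerturbedLayer (freeTowerLaws_king)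
open Summit.QuantumFields.BalabanUV.T4Continuum.PlantedPotentialRate (plantTow perturbationLaws_plantTow)

variable {d : ℕ} (L : ℕ) [NeZero L] (M : Fin d → ℕ) [∀ μ, NeZero (M μ)] (a : ℝ) (ha : 0 < a)

/-- **`TowerLaw` FOR THE KING-AVERAGED PERTURBED TOWERS OVER BAŁABAN's `Δ_a`**: for every family of perturbations `P j` of
`Δ_a^{(k)}` obeying row NE2's `PerturbationLaws` with ONE `κ` and consistency defects `C₂·L^{−k}`, and every `‖t‖κ < 1`:
`TowerLaw (fun _ => Q_L) (pertTower Δ_a P t) L^d (Cpert κ (2dCst) CJ C₂ 0 t) L^{−1}` — the U = 1 inputs are row NE2's THEOREM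
`freeTowerLaws_king`; the one binder of NE2 type is `hpert`. [folklore] -/
theorem towerLaw_perturbed_king {Jx : Type*} {P : Jx → (k : ℕ) → Matrix (idx L M k) (idx L M k) ℂ} {κ C₂ : ℝ}
    (hpert : ∀ j, PerturbationLaws (calDalev L M a ha) (P j) (JpcT L M) κ (fun k => C₂ * ((L : ℝ)⁻¹) ^ k)) {t : ℂ}
    (ht : ‖t‖ * κ < 1) :
    TowerLaw (fun _ : Jx => Qlev L M) (pertTower (calDalev L M a ha) P t) ((L : ℝ) ^ d)
      (Cpert κ (2 * d * Cst d a) (CJ d a) C₂ 0 t) ((L : ℝ)⁻¹) := by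
  have hr : (0 : ℝ) < (L : ℝ) ^ d := pow_pos (by exact_mod_cast Nat.pos_of_ne_zero (NeZero.ne L)) d
  exact towerLaw_perturbed hr (freeTowerLaws_king L M a ha) hpert (fun _ => le_rfl) (fun _ => le_rfl) (fun _ _ => le_rfl)
    (fun _ => by simp) ht

/-- **THE FIRST MODEL CLASS WITH NO BINDER OF NE2 TYPE**: for every family of unit-lattice operators `B j` with `‖B j‖ ≤ b`
planted along King's pairings (row NE2's `plantTow`; King's `(Δ^{(k)} + B)⁻¹` structure on Bałaban's vector layer) and every
coupling `‖t‖·b·Cst < 1`, the perturbed towers obey the socket's `TowerLaw` with constant `Cpert (b·Cst) (2dCst) CJ 0 0 t` and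
rate `L^{−1}` — UNCONDITIONALLY (`perturbationLaws_plantTow` + `perturbationLaws_mono`). [folklore] -/
theorem towerLaw_plantedPotential {Jx : Type*} {B : Jx → Matrix (idx L M 0) (idx L M 0) ℂ} {b : ℝ} (hB : ∀ j, ‖B j‖ ≤ b)
    {t : ℂ} (ht : ‖t‖ * (b * Cst d a) < 1) :
    TowerLaw (fun _ : Jx => Qlev L M) (pertTower (calDalev L M a ha) (fun j => plantTow L M (B j)) t) ((L : ℝ) ^ d)
      (Cpert (b * Cst d a) (2 * d * Cst d a) (CJ d a) 0 0 t) ((L : ℝ)⁻¹) :=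
  towerLaw_perturbed_king L M a ha
    (fun j => perturbationLaws_mono (perturbationLaws_plantTow L M a ha (B j))
      (mul_le_mul_of_nonneg_right (hB j) (Cst_nonneg d a)) (fun _ => le_rfl)) ht

variable {C : Carriers} {Op Hist : Type*} [NormedAddCommGroup Op] [NormedSpace ℂ Op] [NormedAddCommGroup Hist]
  [NormedSpace ℂ Hist] [CompleteSpace Hist] (Mdl : StepModel C Op Hist)

/-- **ROW NE5's END FOR THE PLANTED CLASS — NO BINDER OF NE2 TYPE AND NO η-RATE LAW BINDER AT ALL.**  For operator species an
instantiation reads (`ReadsTower`, constant `cR`) from the King-averaged towers of `(Δ_a^{(k)} + t·P_k)⁻¹`, `P = plantTow (B j)` a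
unit-lattice operator `‖B j‖ ≤ b` planted along King's pairings (one per background index `j`), with `‖t‖·b·Cst < 1`: NE5 follows
from the reading, the [I]-type floor, MI-R, W2, W2-ins (+ `InsBoundA`), W3, `ReadsIns`, R, S — and nothing else; W1's constant is
`δ = cR·Cpert(b·Cst, 2dCst, CJ, 0, 0, t)/r₀`, its rate `L^{−1}` (§3's first face with `hfree := freeTowerLaws_king`,
`hpert := perturbationLaws_plantTow ∘ perturbationLaws_mono`).  Scope as in the header: King's `(Δ^{(k)} + B)⁻¹` STRUCTURE on
Bałaban's vector layer — NOT Bałaban's covariant `Δ_a(U)`. [folklore] -/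
theorem ne5_at_of_plantedPotential_lip_readsIns_nat (Ins : ℕ → Op → (C.Dom → ℝ) → Hist) {Jx : Type*}
    {B : Jx → Matrix (idx L M 0) (idx L M 0) ℂ} {b : ℝ} (hB : ∀ j, ‖B j‖ ≤ b) {t : ℂ} (ht : ‖t‖ * (b * Cst d a) < 1)
    {W : Set (ℕ → ℝ)} {cR r₀ δ : ℝ} {tow : ℕ → (ℕ → ℝ) → C.BgB → Jx} {EA : Functional C C.BgA} {EB : Functional C C.BgB}
    {κ Λ EA₀ E₀ Gi θ' c ω ρ₀ ρ₁ Bc : ℝ} {k₀ k₁ : ℕ}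
    (hread : ReadsTower Mdl (fun _ : Jx => Qlev L M) (pertTower (calDalev L M a ha) (fun j => plantTow L M (B j)) t)
      ((L : ℝ) ^ d) W cR tow)
    (hcR : 0 ≤ cR) (hfl : ∀ k, r₀ ≤ Mdl.rOp k) (hr₀ : 0 < r₀)
    (hδ : cR * Cpert (b * Cst d a) (2 * d * Cst d a) (CJ d a) 0 0 t / r₀ = δ)
    (hrA : Mdl.RepresentsA EA W) (hrB : Mdl.RepresentsB EB W) (hbase : Mdl.InBase EB W) (hlip : Mdl.DataLipschitz W κ Λ ρ₀)
    (hdA : DecayBound EA W EA₀ κ) (hdB : DecayBound EB W E₀ κ) (hreadI : (InsOpModel.ofStep Mdl Ins).ReadsIns W)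
    (hienv : (InsOpModel.ofStep Mdl Ins).InsOpEnvelope W κ E₀ Gi) (hbdA : (InsOpModel.ofStep Mdl Ins).InsBoundA W κ E₀ Gi)
    (hGi : 0 ≤ Gi) (hρ₁ : ρ₁ < 1) (hreach : δ * ((L : ℝ)⁻¹) ^ k₁ ≤ ρ₁) (hdamp : Mdl.InsertionDampedNat W κ c ω) (hΛ : 0 ≤ Λ)
    (hθθ' : (L : ℝ)⁻¹ ≤ θ') (hθ'1 : θ' ≤ 1) (hc : 0 ≤ c) (hω : 0 < ω)
    (hnear : (δ + (Gi * δ / (1 - ρ₁) + 2 * Gi / ((L : ℝ)⁻¹) ^ k₁)) * ((L : ℝ)⁻¹) ^ k₀ + c * (EA₀ + E₀) / (1 - ω) ≤ ρ₀)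
    (hBc : 0 ≤ Bc) (hfirst : ∀ k < k₀, EA₀ + E₀ ≤ Bc * ((L : ℝ)⁻¹) ^ k) (hsmall : ω + Λ * c < θ') :
    NE5 EA EB W κ θ'
      ((Λ * (δ + (Gi * δ / (1 - ρ₁) + 2 * Gi / ((L : ℝ)⁻¹) ^ k₁)) + Bc) * (θ' - ω) / (θ' - (ω + Λ * c))) := by
  have hL : (0 : ℝ) < L := by exact_mod_cast Nat.pos_of_ne_zero (NeZero.ne L)
  have hr : (0 : ℝ) < (L : ℝ) ^ d := pow_pos hL d
  have hC₀ : (0 : ℝ) ≤ 2 * d * Cst d a := by have := Cst_nonneg d a; positivity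
  exact ne5_at_of_perturbed_lip_readsIns_nat Mdl Ins (θ := (L : ℝ)⁻¹) (κP := b * Cst d a) (C₀ := 2 * d * Cst d a)
    (C₁ := CJ d a) (C₂ := 0) (Cf := 0) hr (freeTowerLaws_king L M a ha)
    (fun j => perturbationLaws_mono (perturbationLaws_plantTow L M a ha (B j))
      (mul_le_mul_of_nonneg_right (hB j) (Cst_nonneg d a)) (fun _ => le_rfl))
    (fun _ => le_rfl) (fun _ => le_rfl) (fun _ _ => le_rfl) (fun _ => by simp) hC₀ (CJ_nonneg d a) le_rfl le_rfl ht hread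
    hcR hfl hr₀ hδ hrA hrB hbase hlip hdA hdB hreadI hienv hbdA hGi hρ₁ hreach hdamp hΛ (inv_pos.mpr hL) hθθ' hθ'1 hc hω
    hnear hBc hfirst hsmall

end KingCarrier

end Summit.QuantumFields.BalabanUV.T4Continuum.OutputRateTowerInstance

end
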